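import Summits.Ventures.PercRepro.Night2TwoOneGeneralStructure
import Summits.Ventures.PercRepro.Night2TwoOneColumnB

/-!
# PercRepro — the cell `(2, 1)` with exactly two fat closures, no spread hypothesis: THE COLUMN BOUND (night-2, gen 28)

A set containing a whole class (both points of `G ∖ H₁`, say) and a point of the other class, whose plane part spans
`P`, has NO thin covering preimage: a face at a point of `H₁` has its complement inside `H₁ ∖ K` (rank `4 < 5`), and a
face at a point of the class `G ∖ H₁` would need its class-mate outside the set (`L1_eq_zero_of_class_subset`).  A
loaded target of the completion rule contains a whole class, so `cap2 = capS ≥ 11/18`, while its load is at most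
`37/180` (two sources, each `≤ 37/360`): **`dload_comp_general_le_cap2`**.
-/

namespace PercRepro.Shadow

open Finset PerFlat ThmH

variable {α : Type*} [DecidableEq α] {M : Matroid α} [M.Finite]

section GeneralColumn

variable {G : Finset α}

open scoped Classical in
/-- **A SET CONTAINING THE WHOLE CLASS `G ∖ H₁`, A POINT OF `G ∖ H₀`, WITH A PLANE PART OF RANK `≥ 3`, HAS NO THIN
COVERING PREIMAGE.** -/
theorem L1_eq_zero_of_class_subset (hG : G ∈ flatsQ M (5 + 1)) (hd : (gr M \ G).card = 2)
    (hk : kColoops M G = 1) {B₀ B₁ : Finset α} (hB₀ : B₀ ∈ thinMembers M 5 G) (hB₁ : B₁ ∈ thinMembers M 5 G)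
    (hm₁ : (G \ clF M B₁).card ≤ 2) (hdisj : Disjoint (G \ clF M B₀) (G \ clF M B₁)) {S : Finset α}
    (hSG : S ⊆ G) (hKS : coloops M G ⊆ S) (hSP : 3 ≤ rkN M (S ∩ ((clF M B₀ ∩ clF M B₁) \ coloops M G)))
    {u : α} (hu : u ∈ S ∩ (G \ clF M B₀)) (hcl : G \ clF M B₁ ⊆ S) : L1 M 5 G S = 0 := by
  have hd' : (gr M \ G).card ≤ 5 := by omega
  have hB2 : (G \ clF M B₁).card = 2 := by
    have := two_le_card_sdiff_of_not_lay0 hG hd' (mem_thinMembers.1 hB₁).1 (mem_thinMembers.1 hB₁).2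
    omega
  have hcompl : G \ S ⊆ clF M B₁ := by
    intro x hx
    by_contra h
    exact (Finset.mem_sdiff.1 hx).2 (hcl (Finset.mem_sdiff.2 ⟨(Finset.mem_sdiff.1 hx).1, h⟩))
  unfold L1
  apply Finset.sum_eq_zero
  intro F hF
  exfalso
  have hthin : F ∈ thinMembers M 5 G := by
    rw [Finset.mem_filter, mem_coverPreimages] at hF
    exact mem_thinMembers.2 ⟨hF.1.1, hF.2⟩
  have h1 := thin_coverPreimages_subset_image_coloops hG hd' S hF
  obtain ⟨w, hw, rfl⟩ := Finset.mem_image.1 h1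
  have hwS : w ∈ S := (Finset.mem_sdiff.1 (mem_coloops.1 hw).1).1
  have hwK : w ∉ coloops M G := (Finset.mem_sdiff.1 (mem_coloops.1 hw).1).2
  by_cases hwH : w ∈ clF M B₁
  · exact face_notMem_of_compl_subset hG hd hk hB₁ hSG hKS hcompl hwK hwH
      (mem_membersIn.1 (mem_thinMembers.1 hthin).1).1
  · -- `w` is a point of the class `G ∖ H₁`, whose class-mate also lies in `S`
    have hsing := class_inter_eq_singleton_of_thin_face' hG hd hk hB₀ hB₁ hdisj hSP hu
      (Finset.mem_inter.2 ⟨hwS, Finset.mem_sdiff.2 ⟨hSG hwS, hwH⟩⟩) hthin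
    rw [Finset.inter_eq_left.2 hcl] at hsing
    have := congrArg Finset.card hsing
    rw [hB2, Finset.card_singleton] at this
    omega

open scoped Classical in
/-- The mirror image: the whole class `G ∖ H₀` in the set. -/
theorem L1_eq_zero_of_class_subset' (hG : G ∈ flatsQ M (5 + 1)) (hd : (gr M \ G).card = 2)
    (hk : kColoops M G = 1) {B₀ B₁ : Finset α} (hB₀ : B₀ ∈ thinMembers M 5 G) (hB₁ : B₁ ∈ thinMembers M 5 G)
    (hm₀ : (G \ clF M B₀).card ≤ 2) (hdisj : Disjoint (G \ clF M B₀) (G \ clF M B₁)) {S : Finset α}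
    (hSG : S ⊆ G) (hKS : coloops M G ⊆ S) (hSP : 3 ≤ rkN M (S ∩ ((clF M B₀ ∩ clF M B₁) \ coloops M G)))
    {u' : α} (hu' : u' ∈ S ∩ (G \ clF M B₁)) (hcl : G \ clF M B₀ ⊆ S) : L1 M 5 G S = 0 := by
  have hSP' : 3 ≤ rkN M (S ∩ ((clF M B₁ ∩ clF M B₀) \ coloops M G)) := by
    rwa [Finset.inter_comm (clF M B₁)]
  exact L1_eq_zero_of_class_subset hG hd hk hB₁ hB₀ hm₀ hdisj.symm hSG hKS hSP' hu' hcl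

/-- `cap2 ≥ 11/18` when `L1 = 0`. -/
theorem cap2_ge_of_L1_eq_zero (hd : (gr M \ G).card = 2) (hk : kColoops M G = 1) {S : Finset α} (hSG : S ⊆ G)
    (hL1 : L1 M 5 G S = 0) : (11 / 18 : ℚ) ≤ cap2 M 5 G S := by
  have hcap := capS_ge_eleven_eighteenths_two_one hd hk hSG
  unfold cap2
  rw [hL1, mul_zero, sub_zero]
  exact hcap

open scoped Classical in
/-- **THE COMPLETION LOAD IS AT MOST `37/180` AT EVERY SET** (exactly two fat closures, disjoint missed pairs). -/
theorem dload_comp_general_le (hG : G ∈ flatsQ M (5 + 1)) (hd : (gr M \ G).card = 2)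
    (hk : kColoops M G = 1) (hs : ∀ e ∈ gr M, ∀ f ∈ gr M, e ≠ f → rkN M {e, f} = 2)
    {B₀ B₁ : Finset α} (hB₀ : B₀ ∈ thinMembers M 5 G) (hB₁ : B₁ ∈ thinMembers M 5 G)
    (hm₀ : (G \ clF M B₀).card ≤ 2) (hm₁ : (G \ clF M B₁).card ≤ 2) (hne : clF M B₀ ≠ clF M B₁)
    (hfat : (fatClosures M 5 G 2).card ≤ 2) (hdisj : Disjoint (G \ clF M B₀) (G \ clF M B₁)) (S : Finset α) :
    dload M 5 G (fun B => 5 ≤ (B \ coloops M G).card)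
      (dshComp M 5 G ((G \ clF M B₀) ∪ (G \ clF M B₁))) S ≤ 37 / 180 := by
  have hd' : (gr M \ G).card ≤ 5 := by omega
  have hA2 : (G \ clF M B₀).card = 2 := by
    have := two_le_card_sdiff_of_not_lay0 hG hd' (mem_thinMembers.1 hB₀).1 (mem_thinMembers.1 hB₀).2
    omega
  have hB2 : (G \ clF M B₁).card = 2 := by
    have := two_le_card_sdiff_of_not_lay0 hG hd' (mem_thinMembers.1 hB₁).1 (mem_thinMembers.1 hB₁).2
    omega
  set Xs := (G \ clF M B₀) ∪ (G \ clF M B₁) with hXs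
  have h1 := dload_comp_le_sum_faceLossP (M := M) (q := 5) (G := G)
    (P := fun B => 5 ≤ (B \ coloops M G).card) Xs S
  set N := (Xs ∩ S).filter (fun y =>
    ∑ w ∈ S.erase y, faceLossP M 5 G (fun B => 5 ≤ (B \ coloops M G).card) (S.erase y) w ≠ 0) with hN
  have hNsub : N ⊆ Xs ∩ S := Finset.filter_subset _ _
  have hstruct : ∀ y ∈ N, ∃ u u', u ≠ u' ∧ (S.erase y) ∩ (G \ clF M B₀) = {u} ∧
      (S.erase y) ∩ (G \ clF M B₁) = {u'} := by
    intro y hy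
    have hsum := (Finset.mem_filter.1 hy).2
    obtain ⟨w, hw, hne0⟩ := Finset.exists_ne_zero_of_sum_ne_zero hsum
    obtain ⟨u, u', huu', h₀, h₁, -⟩ :=
      structure_general hG hd hk hs hB₀ hB₁ hm₀ hm₁ hne hfat hdisj ⟨w, hw, hne0⟩
    exact ⟨u, u', huu', h₀, h₁⟩
  have hterm : ∀ y ∈ Xs ∩ S,
      (∑ w ∈ S.erase y, faceLossP M 5 G (fun B => 5 ≤ (B \ coloops M G).card) (S.erase y) w) /
        ((Xs \ S.erase y).card : ℚ) ≤ if y ∈ N then 37 / 360 else 0 := by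
    intro y hy
    split_ifs with hyN
    · obtain ⟨u, u', -, h₀, h₁⟩ := hstruct y hyN
      have hc := card_sdiff_classes_eq_two hdisj hA2 hB2 h₀ h₁
      rw [← hXs] at hc
      rw [hc]
      have := faceLossP_sum_le_general hG hd hk hs hB₀ hB₁ hm₀ hm₁ hne hfat hdisj (S.erase y)
      push_cast
      linarith
    · have hzero : ∑ w ∈ S.erase y, faceLossP M 5 G (fun B => 5 ≤ (B \ coloops M G).card) (S.erase y) w = 0 := by
        by_contra h
        exact hyN (Finset.mem_filter.2 ⟨hy, h⟩)
      rw [hzero, zero_div]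
  have hN2 : N.card ≤ 2 := by
    apply card_filter_le_two_of_singletons hdisj hNsub
    intro y hy
    obtain ⟨u, u', -, h₀, h₁⟩ := hstruct y hy
    exact ⟨⟨u, h₀⟩, ⟨u', h₁⟩⟩
  calc dload M 5 G (fun B => 5 ≤ (B \ coloops M G).card) (dshComp M 5 G Xs) S ≤ _ := h1
    _ ≤ ∑ y ∈ Xs ∩ S, (if y ∈ N then (37 / 360 : ℚ) else 0) := Finset.sum_le_sum hterm
    _ = (N.card : ℚ) * (37 / 360) := by
        rw [Finset.sum_ite_mem, Finset.inter_eq_right.2 hNsub, Finset.sum_const, nsmul_eq_mul]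
    _ ≤ 2 * (37 / 360) := by
        apply mul_le_mul_of_nonneg_right _ (by norm_num)
        exact_mod_cast hN2
    _ = 37 / 180 := by norm_num

open scoped Classical in
/-- **A loaded target meets `Xs` in exactly three points**, and one source `S ∖ y` has the structure of
`structure_general`. -/
theorem card_inter_eq_three_general (hG : G ∈ flatsQ M (5 + 1)) (hd : (gr M \ G).card = 2)
    (hk : kColoops M G = 1) (hs : ∀ e ∈ gr M, ∀ f ∈ gr M, e ≠ f → rkN M {e, f} = 2)
    {B₀ B₁ : Finset α} (hB₀ : B₀ ∈ thinMembers M 5 G) (hB₁ : B₁ ∈ thinMembers M 5 G)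
    (hm₀ : (G \ clF M B₀).card ≤ 2) (hm₁ : (G \ clF M B₁).card ≤ 2) (hne : clF M B₀ ≠ clF M B₁)
    (hfat : (fatClosures M 5 G 2).card ≤ 2) (hdisj : Disjoint (G \ clF M B₀) (G \ clF M B₁)) {S : Finset α}
    (hS : dload M 5 G (fun B => 5 ≤ (B \ coloops M G).card)
      (dshComp M 5 G ((G \ clF M B₀) ∪ (G \ clF M B₁))) S ≠ 0) :
    ∃ y ∈ ((G \ clF M B₀) ∪ (G \ clF M B₁)) ∩ S, ∃ u u', u ≠ u' ∧
      (S.erase y) ∩ (G \ clF M B₀) = {u} ∧ (S.erase y) ∩ (G \ clF M B₁) = {u'} ∧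
      S.erase y ⊆ G ∧ coloops M G ⊆ S.erase y ∧ rkN M (S.erase y \ coloops M G) = 5 ∧
      6 ≤ (S.erase y \ coloops M G).card ∧
      3 ≤ rkN M (S.erase y ∩ ((clF M B₀ ∩ clF M B₁) \ coloops M G)) ∧
      4 ≤ (S.erase y ∩ ((clF M B₀ ∩ clF M B₁) \ coloops M G)).card ∧ 4 ≤ (G \ S.erase y).card ∧
      (S ∩ ((G \ clF M B₀) ∪ (G \ clF M B₁))).card = 3 := by
  have hd' : (gr M \ G).card ≤ 5 := by omega
  set Xs := (G \ clF M B₀) ∪ (G \ clF M B₁) with hXs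
  have h1 := dload_comp_le_sum_faceLossP (M := M) (q := 5) (G := G)
    (P := fun B => 5 ≤ (B \ coloops M G).card) Xs S
  have h0 : 0 ≤ dload M 5 G (fun B => 5 ≤ (B \ coloops M G).card) (dshComp M 5 G Xs) S :=
    dload_nonneg (fun B z S => dshComp_nonneg hG hd' Xs B z S) S
  have hex : ∃ y ∈ Xs ∩ S,
      ∑ w ∈ S.erase y, faceLossP M 5 G (fun B => 5 ≤ (B \ coloops M G).card) (S.erase y) w ≠ 0 := by
    by_contra hcon
    push Not at hcon
    have : ∑ y ∈ Xs ∩ S, (∑ w ∈ S.erase y, faceLossP M 5 G (fun B => 5 ≤ (B \ coloops M G).card) (S.erase y) w) /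
        ((Xs \ S.erase y).card : ℚ) = 0 := by
      apply Finset.sum_eq_zero
      intro y hy
      rw [hcon y hy, zero_div]
    exact hS (le_antisymm (this ▸ h1) h0)
  obtain ⟨y, hy, hsum⟩ := hex
  obtain ⟨w, hw, hne0⟩ := Finset.exists_ne_zero_of_sum_ne_zero hsum
  obtain ⟨u, u', huu', h₀, h₁, hQG, hKQ, hQK5, hQKcard, hP3, hP4, hGQ, -⟩ :=
    structure_general hG hd hk hs hB₀ hB₁ hm₀ hm₁ hne hfat hdisj ⟨w, hw, hne0⟩
  refine ⟨y, hy, u, u', huu', h₀, h₁, hQG, hKQ, hQK5, hQKcard, hP3, hP4, hGQ, ?_⟩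
  have hQX : (S.erase y) ∩ Xs = {u, u'} := by
    rw [hXs, Finset.inter_union_distrib_left, h₀, h₁]
    rfl
  have hSX : S ∩ Xs = insert y ((S.erase y) ∩ Xs) := by
    ext x
    simp only [Finset.mem_inter, Finset.mem_insert, Finset.mem_erase]
    constructor
    · rintro ⟨hxS, hxX⟩
      by_cases hxy : x = y
      · exact Or.inl hxy
      · exact Or.inr ⟨⟨hxy, hxS⟩, hxX⟩
    · rintro (rfl | ⟨⟨-, hxS⟩, hxX⟩)
      · exact ⟨(Finset.mem_inter.1 hy).2, (Finset.mem_inter.1 hy).1⟩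
      · exact ⟨hxS, hxX⟩
  rw [hSX, hQX, Finset.card_insert_of_notMem, Finset.card_pair huu']
  intro h
  rw [← hQX, Finset.mem_inter, Finset.mem_erase] at h
  exact h.1.1 rfl

open scoped Classical in
/-- **THE COLUMN BOUND OF THE COMPLETION RULE, NO SPREAD HYPOTHESIS**: a loaded target contains a whole class, so
`L1 = 0` and `cap2 ≥ 11/18 ≥ 37/180 ≥ dload`. -/
theorem dload_comp_general_le_cap2 (hG : G ∈ flatsQ M (5 + 1)) (hd : (gr M \ G).card = 2)
    (hk : kColoops M G = 1) (hs : ∀ e ∈ gr M, ∀ f ∈ gr M, e ≠ f → rkN M {e, f} = 2)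
    {B₀ B₁ : Finset α} (hB₀ : B₀ ∈ thinMembers M 5 G) (hB₁ : B₁ ∈ thinMembers M 5 G)
    (hm₀ : (G \ clF M B₀).card ≤ 2) (hm₁ : (G \ clF M B₁).card ≤ 2) (hne : clF M B₀ ≠ clF M B₁)
    (hfat : (fatClosures M 5 G 2).card ≤ 2) (hdisj : Disjoint (G \ clF M B₀) (G \ clF M B₁)) :
    ∀ S ∈ shadowAt M (5 + 2) 5 (Uq M (5 + 2) 5) G,
      dload M 5 G (fun B => 5 ≤ (B \ coloops M G).card)
        (dshComp M 5 G ((G \ clF M B₀) ∪ (G \ clF M B₁))) S ≤ cap2 M 5 G S := by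
  intro S hS
  have hd' : (gr M \ G).card ≤ 5 := by omega
  have hSG : S ⊆ G := subset_G_of_mem_shadowAt hS
  have hKS : coloops M G ⊆ S := coloops_subset_of_mem_shadowAt hS
  by_cases h0 : dload M 5 G (fun B => 5 ≤ (B \ coloops M G).card)
      (dshComp M 5 G ((G \ clF M B₀) ∪ (G \ clF M B₁))) S = 0
  · rw [h0]
    exact cap2_nonneg (capS_nonneg' hG hd' S)
  · have hle := dload_comp_general_le hG hd hk hs hB₀ hB₁ hm₀ hm₁ hne hfat hdisj S
    obtain ⟨y, hy, u, u', huu', h₀, h₁, -, -, -, -, hP3, -, -, -⟩ :=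
      card_inter_eq_three_general hG hd hk hs hB₀ hB₁ hm₀ hm₁ hne hfat hdisj h0
    have hA2 : (G \ clF M B₀).card = 2 := by
      have := two_le_card_sdiff_of_not_lay0 hG hd' (mem_thinMembers.1 hB₀).1 (mem_thinMembers.1 hB₀).2
      omega
    have hB2 : (G \ clF M B₁).card = 2 := by
      have := two_le_card_sdiff_of_not_lay0 hG hd' (mem_thinMembers.1 hB₁).1 (mem_thinMembers.1 hB₁).2
      omega
    have hyS : y ∈ S := (Finset.mem_inter.1 hy).2
    have hyX := (Finset.mem_inter.1 hy).1
    -- the plane part of `S` is that of `S ∖ y`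
    have hyP : y ∉ (clF M B₀ ∩ clF M B₁) \ coloops M G := by
      intro h
      rw [Finset.mem_sdiff, Finset.mem_inter] at h
      rw [Finset.mem_union, Finset.mem_sdiff, Finset.mem_sdiff] at hyX
      rcases hyX with hh | hh
      · exact hh.2 h.1.1
      · exact hh.2 h.1.2
    have hSP : S ∩ ((clF M B₀ ∩ clF M B₁) \ coloops M G) =
        S.erase y ∩ ((clF M B₀ ∩ clF M B₁) \ coloops M G) := by
      ext x
      simp only [Finset.mem_inter, Finset.mem_erase]
      constructor
      · rintro ⟨hxS, hxP⟩
        exact ⟨⟨fun h => hyP (h ▸ hxP), hxS⟩, hxP⟩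
      · rintro ⟨⟨-, hxS⟩, hxP⟩
        exact ⟨hxS, hxP⟩
    have hSP3 : 3 ≤ rkN M (S ∩ ((clF M B₀ ∩ clF M B₁) \ coloops M G)) := by rw [hSP]; exact hP3
    have huQ : u ∈ (S.erase y) ∩ (G \ clF M B₀) := by rw [h₀]; exact Finset.mem_singleton_self _
    have hu'Q : u' ∈ (S.erase y) ∩ (G \ clF M B₁) := by rw [h₁]; exact Finset.mem_singleton_self _
    have huS : u ∈ S ∩ (G \ clF M B₀) :=
      Finset.mem_inter.2 ⟨Finset.mem_of_mem_erase (Finset.mem_inter.1 huQ).1, (Finset.mem_inter.1 huQ).2⟩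
    have hu'S : u' ∈ S ∩ (G \ clF M B₁) :=
      Finset.mem_inter.2 ⟨Finset.mem_of_mem_erase (Finset.mem_inter.1 hu'Q).1, (Finset.mem_inter.1 hu'Q).2⟩
    have huy : u ≠ y := fun h => (Finset.mem_erase.1 (Finset.mem_inter.1 huQ).1).1 h
    have hu'y : u' ≠ y := fun h => (Finset.mem_erase.1 (Finset.mem_inter.1 hu'Q).1).1 h
    -- the class of `y` lies inside `S`
    have hL1 : L1 M 5 G S = 0 := by
      rw [Finset.mem_union] at hyX
      rcases hyX with hyA | hyB
      · -- `G ∖ H₀ = {u, y} ⊆ S`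
        have hcl : G \ clF M B₀ ⊆ S := by
          have hsub : ({u, y} : Finset α) ⊆ G \ clF M B₀ := by
            intro x hx
            rw [Finset.mem_insert, Finset.mem_singleton] at hx
            rcases hx with rfl | rfl
            · exact (Finset.mem_inter.1 huS).2
            · exact hyA
          have heq : ({u, y} : Finset α) = G \ clF M B₀ := by
            apply Finset.eq_of_subset_of_card_le hsub
            rw [Finset.card_pair huy]; exact hA2.le
          rw [← heq]
          intro x hx
          rw [Finset.mem_insert, Finset.mem_singleton] at hx
          rcases hx with rfl | rfl
          · exact (Finset.mem_inter.1 huS).1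
          · exact hyS
        exact L1_eq_zero_of_class_subset' hG hd hk hB₀ hB₁ hm₀ hdisj hSG hKS hSP3 hu'S hcl
      · have hcl : G \ clF M B₁ ⊆ S := by
          have hsub : ({u', y} : Finset α) ⊆ G \ clF M B₁ := by
            intro x hx
            rw [Finset.mem_insert, Finset.mem_singleton] at hx
            rcases hx with rfl | rfl
            · exact (Finset.mem_inter.1 hu'S).2
            · exact hyB
          have heq : ({u', y} : Finset α) = G \ clF M B₁ := by
            apply Finset.eq_of_subset_of_card_le hsub
            rw [Finset.card_pair hu'y]; exact hB2.le
          rw [← heq]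
          intro x hx
          rw [Finset.mem_insert, Finset.mem_singleton] at hx
          rcases hx with rfl | rfl
          · exact (Finset.mem_inter.1 hu'S).1
          · exact hyS
        exact L1_eq_zero_of_class_subset hG hd hk hB₀ hB₁ hm₁ hdisj hSG hKS hSP3 huS hcl
    have hc2 := cap2_ge_of_L1_eq_zero hd hk hSG hL1
    linarith

end GeneralColumn

end PercRepro.Shadow
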